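import Literature.NumberTheory.GaloisRepresentations.SemiLocalUnitGroupUnramifiedNorm
import Literature.Algebra.Homology.HerbrandQuotient
import Literature.Algebra.Homology.TateCohomologyFiniteCyclic
import HarnessLib

/-!
# The bridge between the tree's Herbrand indices and Mathlib's Tate cohomology:
# `Herbrand.h0 σ A ⊥ = #Ĥ⁰(G, A)` for a cyclic group `G = ⟨σ⟩` and a `G`-stable subgroup `A` (Serre VIII §4; Brown VI §4)

Topic `NumberTheory/GaloisRepresentations`; namespace `Literature.NumberTheory.GaloisRepresentations.Herbrand`.
Theorems and one definition (the comparison equivalence); NO named fact, no `sorry`, no instance, no notation;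
`G M : Type` (Mathlib's `tateCohomology` wants the coefficient ring `ℤ` and the group in one universe).

The tree computes class-field-theoretic indices in two dialects: the INDEX dialect of Childress, *Class Field
Theory* Ch. 4 §4 (`CyclicHerbrandQuotient.lean`: for a `MulDistribMulAction G M`, a generator `σ` of the cyclic
group `G` and a `G`-stable subgroup `A ≤ M`, `Herbrand.h0 σ A ⊥ = [A^σ : N_G A]` and `h1 σ A ⊥`, natural numbers
built from `Subgroup.relIndex`; consumers: `SemiLocalUnits`, `ArchimedeanHerbrand`, `UnitIdelesHerbrand`,
`IdeleClassHerbrand`, `HasseNormCyclicIdelic`, …) and the COHOMOLOGY dialect of the Route-A engine (Mathlib's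
`tateCohomology (A : Rep ℤ G) n`; the tree's `TateNormMap.tateCohomologyZeroIso : Ĥ⁰(G, A) ≅ A^G/N̄A_G`, Brown VI
§4).  This file identifies them in degree `0`: for the representation `Herbrand.stableRepr` of `G` on
`Additive A` (`SemiLocalUnitGroupShapiro.lean` §0),

  `Herbrand.h0 σ A ⊥ = Nat.card (tateCohomology (Rep.of (stableRepr _ A _)) 0)`,

so that every Herbrand computation of the index dialect becomes a statement about `Ĥ⁰` (and, by the period-two
isomorphism of the engine's `TateCohomologyFiniteCyclic`, about `H²`).  The proof is bookkeeping: `z0 σ A ⊥ = A^σ =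
A^G` (σ generates), `b0 G A ⊥ = N_G A`, `relIndex = Nat.card` of a quotient of subgroups, and an explicit
equivalence with `A^G / N̄ A_G` (`Quotient.congr`), the additive norm `∑_g ρ(g)` of `stableRepr` being the
multiplicative norm `∏_g g •` of the index dialect.

## What is formalised (`G M : Type`, `[Group G] [Fintype G] [CommGroup M] [MulDistribMulAction G M]`,
`A : Subgroup M` with `hA : ∀ g a, a ∈ A → g • a ∈ A`, `σ` a generator of `G`)

* `coe_toMul_stableRepr_smul`, `mem_invariants_stableRepr_iff` (`x ∈ (Additive A)^G ↔ ∀ g, g • x = x`),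
  `mem_range_norm_stableRepr_iff` (`range N ↔ A.map (norm G)`; the norm itself is the tree's
  `Herbrand.coe_toMul_norm_stableRepr` of `SemiLocalUnitGroupUnramifiedNorm.lean`).
* `fixedEquivInvariants σ hσ : z0 σ A ⊥ ≃ invariants` and **`h0_bot_eq_natCard_H0`**,
  **`h0_bot_eq_natCard_tateCohomology_zero : h0 σ A ⊥ = Nat.card Ĥ⁰(G, A)`**.

Not here: `h1 σ A ⊥ = Nat.card Ĥ⁻¹(G, A)` (the same bookkeeping with `ker N̄ ⊆ A_G` and `I_G A = (σ-1)A`) and the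
relative indices `h0 σ A C` for `C ≠ ⊥` (quotient modules).

## References
* J.-P. Serre, *Local Fields*, GTM 67 (1979), Ch. VIII §4 (the groups `H⁰(A) = A^G/NA`, Herbrand quotient).
  [SerreLocalFields1979]
* K. S. Brown, *Cohomology of Groups*, GTM 87 (1982), VI §4 (`Ĥ⁰ = coker N̄`). [Brown1982CohomologyGroups]
* N. Childress, *Class Field Theory* (2009), Ch. 4 §4 (the indices `h0`, `h1`). [Childress2009]
-/

noncomputable section

open CategoryTheory

namespace Literature.NumberTheory.GaloisRepresentations

namespace Herbrand

open Literature.Algebra.Homology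

variable {G M : Type} [Group G] [Fintype G] [CommGroup M] [MulDistribMulAction G M]
variable (A : Subgroup M) (hA : ∀ (g : G) (a : M), a ∈ A → MulDistribMulAction.toMulAut G M g a ∈ A)

/-! ## §1. The representation `stableRepr` on `Additive A`: action, invariants, norm -/

omit [Fintype G] in
/-- The stable-subgroup representation for the action `MulDistribMulAction.toMulAut G M` acts by `g • ·`.
[cite: Brown1982CohomologyGroups, III §5] -/
theorem coe_toMul_stableRepr_smul (g : G) (x : Additive A) :
    ((Additive.toMul (stableRepr (MulDistribMulAction.toMulAut G M) A hA g x) : A) : M) =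
      g • ((Additive.toMul x : A) : M) := rfl

omit [Fintype G] in
/-- **Invariants of `stableRepr` are the `G`-fixed elements of `A`.** [cite: SerreLocalFields1979, Ch. VIII §4] -/
theorem mem_invariants_stableRepr_iff (x : Additive A) :
    x ∈ (stableRepr (MulDistribMulAction.toMulAut G M) A hA).invariants ↔
      ∀ g : G, g • ((Additive.toMul x : A) : M) = ((Additive.toMul x : A) : M) := by
  refine forall_congr' fun g => ⟨fun h => ?_, fun h => ?_⟩
  · have := congrArg (fun y : Additive A => ((Additive.toMul y : A) : M)) h
    simpa only [coe_toMul_stableRepr_smul] using this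
  · apply Additive.toMul.injective
    exact Subtype.ext (by rw [coe_toMul_stableRepr_smul]; exact h)

/-- **The range of the additive norm of `stableRepr` is `N_G(A)`.** [cite: SerreLocalFields1979, Ch. VIII §4] -/
theorem mem_range_norm_stableRepr_iff (y : Additive A) :
    y ∈ LinearMap.range (stableRepr (MulDistribMulAction.toMulAut G M) A hA).norm ↔
      ((Additive.toMul y : A) : M) ∈ A.map (norm G) := by
  constructor
  · rintro ⟨x, rfl⟩
    rw [coe_toMul_norm_stableRepr]
    exact ⟨_, (Additive.toMul x).2, rfl⟩
  · rintro ⟨a, ha, hay⟩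
    refine ⟨Additive.ofMul ⟨a, ha⟩, ?_⟩
    apply Additive.toMul.injective
    exact Subtype.ext (by rw [coe_toMul_norm_stableRepr]; exact hay)

/-! ## §2. `z0 σ A ⊥ ≃ (Additive A)^G` and `h0 σ A ⊥ = #Ĥ⁰(G, A)` -/

/-- An element fixed by a generator is fixed by the whole cyclic group. [folklore] -/
private theorem smul_eq_self_of_generator {σ : G} (hσ : ∀ g : G, g ∈ Subgroup.zpowers σ) {a : M}
    (ha : σ • a = a) (g : G) : g • a = a := by
  obtain ⟨k, rfl⟩ := exists_pow_eq_of_forall_mem_zpowers hσ g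
  induction k with
  | zero => rw [pow_zero, one_smul]
  | succ k ih => rw [pow_succ, mul_smul, ha, ih]

/-- **`z0 σ A ⊥ = A^σ` is in bijection with the invariants `(Additive A)^G`** (σ generates `G`), by `a ↦ a`.
[cite: SerreLocalFields1979, Ch. VIII §4] -/
def fixedEquivInvariants {σ : G} (hσ : ∀ g : G, g ∈ Subgroup.zpowers σ) :
    z0 σ A ⊥ ≃ (stableRepr (MulDistribMulAction.toMulAut G M) A hA).invariants where
  toFun a := ⟨Additive.ofMul ⟨(a : M), (mem_z0_bot.mp a.2).1⟩,
    (mem_invariants_stableRepr_iff A hA _).mpr fun g =>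
      smul_eq_self_of_generator hσ (mem_z0_bot.mp a.2).2 g⟩
  invFun x := ⟨((Additive.toMul (x : Additive A) : A) : M),
    mem_z0_bot.mpr ⟨(Additive.toMul (x : Additive A)).2, (mem_invariants_stableRepr_iff A hA _).mp x.2 σ⟩⟩
  left_inv _ := Subtype.ext rfl
  right_inv _ := Subtype.ext rfl

/-- Underlying element of `fixedEquivInvariants` (definitional). [cite: SerreLocalFields1979, Ch. VIII §4] -/
theorem coe_toMul_fixedEquivInvariants {σ : G} (hσ : ∀ g : G, g ∈ Subgroup.zpowers σ) (a : z0 σ A ⊥) :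
    ((Additive.toMul ((fixedEquivInvariants A hA hσ a : (stableRepr (MulDistribMulAction.toMulAut G M) A
      hA).invariants) : Additive A) : A) : M) = (a : M) := rfl

/-- **`h0 σ A ⊥ = |A^G / N̄ A_G|`** (Serre's `H⁰(A) = A^G/NA` for the module `Additive A`): the index
`[A^σ : N_G A]` is the cardinality of the engine's `Herbrand.H0`. [cite: SerreLocalFields1979, Ch. VIII §4] -/
theorem h0_bot_eq_natCard_H0 {σ : G} (hσ : ∀ g : G, g ∈ Subgroup.zpowers σ) :
    h0 σ A ⊥ = Nat.card (Literature.Algebra.Homology.Herbrand.H0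
      (Rep.of (stableRepr (MulDistribMulAction.toMulAut G M) A hA))) := by
  rw [h0_def, b0_bot, Subgroup.relIndex, Subgroup.index]
  refine Nat.card_congr (Quotient.congr (fixedEquivInvariants A hA hσ) fun a b => ?_)
  rw [QuotientGroup.leftRel_apply, Subgroup.mem_subgroupOf]
  change ((a⁻¹ * b : z0 σ A ⊥) : M) ∈ A.map (norm G) ↔
    QuotientAddGroup.leftRel _ (fixedEquivInvariants A hA hσ a) (fixedEquivInvariants A hA hσ b)
  rw [QuotientAddGroup.leftRel_apply, Submodule.mem_toAddSubgroup, mem_range_normBar_iff,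
    Submodule.coe_add, Submodule.coe_neg, Rep.of_ρ, mem_range_norm_stableRepr_iff, toMul_add, toMul_neg]
  simp only [Subgroup.coe_mul, Subgroup.coe_inv, coe_toMul_fixedEquivInvariants]

/-- **`Herbrand.h0 σ A ⊥ = #Ĥ⁰(G, A)`**: the tree's Herbrand index of a `G`-stable subgroup `A` (for the cyclic
group `G = ⟨σ⟩`) is the cardinality of Mathlib's Tate cohomology `Ĥ⁰(G, Additive A)` (Brown VI §4
`Ĥ⁰ = coker N̄`, the engine's `tateCohomologyZeroIso`). [cite: SerreLocalFields1979, Ch. VIII §4][cite: Brown1982CohomologyGroups, VI §4] -/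
theorem h0_bot_eq_natCard_tateCohomology_zero {σ : G} (hσ : ∀ g : G, g ∈ Subgroup.zpowers σ) :
    h0 σ A ⊥ = Nat.card (tateCohomology
      (Rep.of (stableRepr (MulDistribMulAction.toMulAut G M) A hA)) 0) := by
  rw [h0_bot_eq_natCard_H0 A hA hσ, Literature.Algebra.Homology.Herbrand.natCard_H0_eq]

/-- **`Herbrand.h0 σ A ⊥ = #H²(G, A)`** for the cyclic group `G = ⟨σ⟩` (period two: `Ĥ² ≅ Ĥ⁰`, the engine's
`FiniteCyclic.tateCohomologyIsoOfEvenIff`, and `Ĥ² = H²`). [cite: SerreLocalFields1979, Ch. VIII §4 Prop. 6 Corollary] -/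
theorem h0_bot_eq_natCard_groupCohomology_two {σ : G} (hσ : ∀ g : G, g ∈ Subgroup.zpowers σ) :
    h0 σ A ⊥ = Nat.card (groupCohomology
      (Rep.of (stableRepr (MulDistribMulAction.toMulAut G M) A hA)) 2) := by
  classical
  haveI : IsCyclic G := ⟨⟨σ, hσ⟩⟩
  letI : CommGroup G := IsCyclic.commGroup
  rw [h0_bot_eq_natCard_tateCohomology_zero A hA hσ]
  refine (Nat.card_congr (FiniteCyclic.tateCohomologyIsoOfEvenIff (Rep.of (stableRepr
    (MulDistribMulAction.toMulAut G M) A hA)) σ hσ 0 2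
    ⟨fun _ => ⟨1, rfl⟩, fun _ => ⟨0, rfl⟩⟩).toLinearEquiv.toEquiv).trans ?_
  exact Nat.card_congr ((TateCohomology.isoGroupCohomology 2).app _).toLinearEquiv.toEquiv

end Herbrand

end Literature.NumberTheory.GaloisRepresentations

end
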